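import Literature.Analysis.PDE.TorusQuasilinearLocalExistence
import Literature.Analysis.OperatorTheory.PositiveSqrtSmooth
import HarnessLib

/-!
# Local classical solutions of quasilinear symmetric hyperbolic systems on `𝕋³` (and on `𝕋ᵈ`,
# every `d`) with a GENERAL symmetric positive definite symmetriser, for data with compact range
# in the domain of the coefficients (topic `Analysis/PDE`)

Analysis/PDE proof file (theorems only; no definitions, no named facts). This is the classical
local existence theorem for quasilinear symmetric hyperbolic systems
`A₀(U)∂ₜU + ∑ⱼ Aⱼ(U)∂ⱼU = 0` on the flat torus `𝕋³` in the `C^∞` class, in the generality in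
which it is printed (Majda 1984, Ch. 2 §2.1, Thm 2.1 with Cor. 1–2 of Thm 2.2; Dafermos 2005,
§5.1, Thm 5.1.1, Steps 1–4 of the proof; Kato 1975, Thms I–II): the coefficients `A₀, Aⱼ` are
smooth symmetric operator fields on an OPEN set of states `𝒪` of a finite-dimensional real inner
product space `W`, `A₀` is positive definite on `𝒪` — NOT necessarily diagonal — and the smooth
datum `U₀ : 𝕋³ → W` takes values in a compact `K ⊆ 𝒪`; then there are `T > 0` and a jointly
smooth `V` on `(-T, T) × 𝕋³` with values in `𝒪`, `V(0) = U₀`, solving the system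
(`exists_smooth_solution_of_compact_range`), its forward version on `[0, T) × 𝕋³` with the
one-sided time derivative (`exists_smooth_solution_of_compact_range_Ico`), and the same statement
in MATRIX language on `ℝᴺ` (`symmHyperbolicLocalExistence_matrix`) — verbatim the hypothesis
`H` of `Literature.MathematicalPhysics.KineticTheory.hsEuler_localExistence_of_symmHyperbolicLocalExistence`
(`HardSphereEulerSymmetricForm`), which is thereby PROVED in full generality. The companion file
`TorusQuasilinearLocalExistence` treats the case of a DIAGONAL `A₀` (congruence
`diag(aᵢᵢ^{-1/2})`), which suffices for the Euler system; the general case is what other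
symmetrisable systems of continuum physics (MHD, elasticity, relativistic fluids; Dafermos
§§3.3, 5.4) need, and it is the printed theorem.

Generic dimension: the three statements are proved first on `𝕋ᵈ` for EVERY `d`
(`exists_smooth_solution_of_compact_range_dim`, `exists_smooth_solution_of_compact_range_Ico_dim`,
`symmHyperbolicLocalExistence_matrix_dim (d N : ℕ) …`) through Majda's theorem on `𝕋ᵈ` in the
`C^∞` class `IsQLSymmCoeff.exists_smooth_solution_of_wordSup` at the Sobolev margin `σ = d + 1`,
hypothesis-free by the word-form sup embedding `Torus.wordSupEmbedding_fin` (Majda 1984, Thm 2.1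
is stated in any number of space variables; Kato 1975, Thm II); the `𝕋³` statements below are
their `d = 3` instances, with unchanged statements. `symmHyperbolicLocalExistence_matrix_dim d` is
literally the named fact `SymmHyperbolicLocalExistenceDim d` (`[X_d]`) for every `d`.

The analytic core — Majda's energy method and Picard scheme for GLOBALLY defined coefficients
with a uniformly coercive bounded symmetriser and a smooth congruence `Q A₀ P = 1` — is the tree
theorem `IsQLSymmCoeff.exists_smooth_solution` (`TorusQuasilinearLimit`). This file performs the
two reductions of the printed proof that lead to it:

1. **cut-off of the coefficients off a neighbourhood of the data** (Majda: "we modify the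
   coefficients outside a neighbourhood `G₂` of `Ḡ₁`"; Dafermos: "fix any open subset `ℬ` …
   which contains the closure of the range of `U₀` and whose closure is contained in `𝒪`") by the
   smooth Urysohn function of `CoefficientCutoff` (`ã₀ = χA₀ + (1 - χ)1`, `ãⱼ = χAⱼ`: globally
   smooth, symmetric, `ã₀` uniformly coercive and bounded);
2. **the congruence** `P = Q = (√ã₀)⁻¹` for a GENERAL symmetric positive definite `ã₀`, smooth
   by the smoothness of the inverse positive square root on symmetric positive definite operators
   (`OperatorTheory/PositiveSqrtSmooth`, `contDiffOn_inverse_posSqrt`), symmetric, with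
   `Q ã₀ P = 1` (`inner_inverse_posSqrt_symm`, `inverse_posSqrt_apply_apply`);

and the final localisation: by the tube lemma on the compact torus
(`IsSmoothSpaceTimeOn.eventually_norm_sub_lt`) and `IsCompact.exists_cthickening_subset_open`,
the solution of the cut-off system stays, for short time, in the neighbourhood of `K` on which the
coefficients were not modified, so it solves the original system and takes values in `𝒪`.

## Mathlib / tree search

Tree: `IsQLSymmCoeff`, `IsQLSymmCoeff.exists_smooth_solution`,
`IsQLSymmCoeff.exists_smooth_solution_of_wordSup` (`TorusQuasilinearAPriori`,
`TorusQuasilinearLimit`), `Torus.wordSupEmbedding_fin` (`TorusWordSupEmbedding`);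
`exists_contDiff_cutoff_eq_one_nhds`, `contDiff_cutoffComb`,
`cutoffComb_eq_of_eq_one`, `inner_cutoffComb_symm`, `le_inner_cutoffComb_self`,
`exists_forall_norm_iteratedFDeriv_cutoffComb_le` (`CoefficientCutoff`); `IsPosDefSymm`,
`posSqrt`, `IsPosDefSymm.isPosDefSymm_posSqrt`, `IsPosDefSymm.posSqrt_mul_posSqrt`,
`IsPosDefSymm.isUnit`, `contDiffOn_inverse_posSqrt` (`OperatorTheory/PositiveSqrtSmooth`);
`contDiffOn_toEuclideanCLM`, `inner_toEuclideanCLM_symm`, `inner_toEuclideanCLM_pos`,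
`symmHyperbolicLocalExistence_of_diagonal` (`TorusQuasilinearLocalExistence`, the diagonal
case); `IsSmoothSpaceTimeOn.mono/.eventually_norm_sub_lt/.hasDerivWithinAt_slice`
(`TorusSpaceTime`, `TorusCalculusProofs`). Mathlib: `Ring.inverse_mul_cancel`,
`Ring.mul_inverse_cancel`, `IsCompact.exists_cthickening_subset_open`,
`DifferentiableAt.derivWithin`, `uniqueDiffOn_Ico`, `Matrix.isHermitian_iff_isSymm`,
`Matrix.ofLp_toEuclideanCLM`.

## References

* A. Majda, *Compressible Fluid Flow and Systems of Conservation Laws in Several Space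
  Variables*, Springer 1984, Ch. 2 §2.1, Thm 2.1 and its proof; Thm 2.2, Cor. 1–2. [`Majda1984`]
* C. M. Dafermos, *Hyperbolic Conservation Laws in Continuum Physics*, 2nd ed., Springer 2005,
  §5.1, Thm 5.1.1 and its proof (pp. 122–126). [`Dafermos2005`]
* T. Kato, The Cauchy problem for quasi-linear symmetric hyperbolic systems, Arch. Rational
  Mech. Anal. 58 (1975) 181–205, Thms I–II. [`Kato1975`]
-/

noncomputable section

open Set Filter Function Metric Matrix
open scoped ContDiff Topology InnerProductSpace

namespace Literature.Analysis.PDE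

open Literature.Analysis.FunctionSpaces Literature.Analysis.FunctionSpaces.Torus
open Literature.Analysis.OperatorTheory

universe u

variable {W : Type u} [NormedAddCommGroup W] [InnerProductSpace ℝ W]

/-! ## The congruence `P = Q = (√A₀)⁻¹` -/

section Congruence

variable [FiniteDimensional ℝ W]

omit [FiniteDimensional ℝ W] in
/-- A symmetric operator with a coercivity constant is symmetric positive definite. [folklore] -/
theorem isPosDefSymm_of_coercive {T : W →L[ℝ] W}
    (hs : ∀ w w' : W, ⟪T w, w'⟫_ℝ = ⟪w, T w'⟫_ℝ) {c₀ : ℝ} (hc₀ : 0 < c₀)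
    (hco : ∀ w : W, c₀ * ‖w‖ ^ 2 ≤ ⟪T w, w⟫_ℝ) : IsPosDefSymm T :=
  ⟨hs, fun w hw => lt_of_lt_of_le (mul_pos hc₀ (pow_pos (norm_pos_iff.2 hw) 2)) (hco w)⟩

/-- `(√T)⁻¹ · √T = 1` for `T` symmetric positive definite. [folklore] -/
theorem inverse_posSqrt_mul_posSqrt {T : W →L[ℝ] W} (hT : IsPosDefSymm T) :
    Ring.inverse (posSqrt T) * posSqrt T = 1 :=
  Ring.inverse_mul_cancel _ hT.isPosDefSymm_posSqrt.isUnit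

/-- `√T · (√T)⁻¹ = 1` for `T` symmetric positive definite. [folklore] -/
theorem posSqrt_mul_inverse_posSqrt {T : W →L[ℝ] W} (hT : IsPosDefSymm T) :
    posSqrt T * Ring.inverse (posSqrt T) = 1 :=
  Ring.mul_inverse_cancel _ hT.isPosDefSymm_posSqrt.isUnit

/-- **`(√T)⁻¹` is symmetric** for `T` symmetric positive definite. [folklore] -/
theorem inner_inverse_posSqrt_symm {T : W →L[ℝ] W} (hT : IsPosDefSymm T) (x y : W) :
    ⟪Ring.inverse (posSqrt T) x, y⟫_ℝ = ⟪x, Ring.inverse (posSqrt T) y⟫_ℝ := by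
  set S := posSqrt T with hS_def
  set R := Ring.inverse (posSqrt T) with hR_def
  have hS : IsPosDefSymm S := hT.isPosDefSymm_posSqrt
  have hSR : S * R = 1 := posSqrt_mul_inverse_posSqrt hT
  have h1 : y = S (R y) := by
    have h := congrArg (fun L : W →L[ℝ] W => L y) hSR
    simpa using h.symm
  have h2 : x = S (R x) := by
    have h := congrArg (fun L : W →L[ℝ] W => L x) hSR
    simpa using h.symm
  calc ⟪R x, y⟫_ℝ = ⟪R x, S (R y)⟫_ℝ := by rw [← h1]
    _ = ⟪S (R x), R y⟫_ℝ := (hS.symm (R x) (R y)).symm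
    _ = ⟪x, R y⟫_ℝ := by rw [← h2]

/-- **`(√T)⁻¹ T (√T)⁻¹ = 1`**: the congruence of a symmetric positive definite operator to the
identity. [folklore] -/
theorem inverse_posSqrt_apply_apply {T : W →L[ℝ] W} (hT : IsPosDefSymm T) (w : W) :
    Ring.inverse (posSqrt T) (T (Ring.inverse (posSqrt T) w)) = w := by
  set S := posSqrt T with hS_def
  set R := Ring.inverse (posSqrt T) with hR_def
  have hSS : S * S = T := hT.posSqrt_mul_posSqrt
  have hRS : R * S = 1 := inverse_posSqrt_mul_posSqrt hT
  have hSR : S * R = 1 := posSqrt_mul_inverse_posSqrt hT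
  have h : R * T * R = 1 := by
    rw [← hSS, ← mul_assoc, hRS, one_mul, hSR]
  have h' := congrArg (fun L : W →L[ℝ] W => L w) h
  simpa using h'

/-- **The inverse square root of a smooth uniformly positive symmetric operator field is
smooth.** [folklore] -/
theorem contDiff_inverse_posSqrt_comp {E : Type*} [NormedAddCommGroup E] [NormedSpace ℝ E]
    {a0 : E → (W →L[ℝ] W)} (ha : ContDiff ℝ ∞ a0) (hpd : ∀ v, IsPosDefSymm (a0 v)) :
    ContDiff ℝ ∞ fun v => Ring.inverse (posSqrt (a0 v)) :=
  contDiffOn_inverse_posSqrt.comp_contDiff ha fun v => hpd v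

end Congruence

/-! ## Local existence for data with compact range in the domain of the coefficients -/

section LocalExistence

variable [CompleteSpace W] [FiniteDimensional ℝ W]

/-! ### On `𝕋ᵈ`, every `d` -/

/-- **Local classical solutions of quasilinear symmetric hyperbolic systems on `𝕋ᵈ`, EVERY `d`**
(Majda 1984, Thm 2.1 with Cor. 1–2 of Thm 2.2 — stated in any number of space variables; Dafermos
2005, Thm 5.1.1, existence; Kato 1975, Thm II). Let `A₀, A₁, …, A_d : W → End(W)` (`Aⱼ`, `j < d`)
be smooth on an open set `𝒪` of the finite-dimensional real inner product space `W`, with `A₀(v)`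
symmetric positive definite and `Aⱼ(v)` symmetric for `v ∈ 𝒪`, and let `U₀ : 𝕋ᵈ → W` be smooth
with values in a compact `K ⊆ 𝒪`. Then there are `T > 0` and `V` jointly `C^∞` on
`(-T, T) × 𝕋ᵈ`, with values in `𝒪`, `V(0) = U₀`, and `A₀(V)∂ₜV + ∑ⱼ Aⱼ(V)∂ⱼV = 0` on
`(-T, T) × 𝕋ᵈ`. Proof: word for word the `𝕋³` proof (`exists_smooth_solution_of_compact_range`,
the `d = 3` instance) — cut-off, congruence `P = Q = (√ã₀)⁻¹`, Majda's theorem on `𝕋ᵈ` in the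
`C^∞` class `IsQLSymmCoeff.exists_smooth_solution_of_wordSup` at the Sobolev margin `σ = d + 1`
(hypothesis-free through the word-form sup embedding
`Torus.wordSupEmbedding_fin : d < 2σ → WordSupEmbedding (Fin d) σ`), tube lemma on the compact `𝕋ᵈ`.
[cite: Majda1984, Ch. 2 §2.1, Thm 2.1; Dafermos2005, Thm 5.1.1; Kato1975, Thm II] -/
theorem exists_smooth_solution_of_compact_range_dim {d : ℕ} {O : Set W} (hO : IsOpen O)
    {A0 : W → (W →L[ℝ] W)} {A : Fin d → W → (W →L[ℝ] W)}
    (hA0 : ContDiffOn ℝ ∞ A0 O) (hA : ∀ j, ContDiffOn ℝ ∞ (A j) O)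
    (hsymm0 : ∀ v ∈ O, ∀ w w' : W, ⟪A0 v w, w'⟫_ℝ = ⟪w, A0 v w'⟫_ℝ)
    (hpos : ∀ v ∈ O, ∀ w : W, w ≠ 0 → 0 < ⟪A0 v w, w⟫_ℝ)
    (hsymm : ∀ j, ∀ v ∈ O, ∀ w w' : W, ⟪A j v w, w'⟫_ℝ = ⟪w, A j v w'⟫_ℝ)
    {K : Set W} (hK : IsCompact K) (hKO : K ⊆ O)
    {U₀ : UnitAddTorus (Fin d) → W} (hU₀ : IsSmooth U₀) (hU₀K : ∀ x, U₀ x ∈ K) :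
    ∃ T : ℝ, 0 < T ∧ ∃ V : ℝ → UnitAddTorus (Fin d) → W,
      IsSmoothSpaceTimeOn (Ioo (-T) T) V ∧ V 0 = U₀ ∧ (∀ t ∈ Ioo (-T) T, ∀ x, V t x ∈ O) ∧
      ∀ t ∈ Ioo (-T) T, ∀ x,
        A0 (V t x) (timeDeriv V t x) + ∑ j, A j (V t x) (partialDeriv j (V t) x) = 0 := by
  -- Step 1: the cut-off
  obtain ⟨χ, hχ, hχc, hχO, hχ01, O', hO', hKO', hO'O, hχ1⟩ :=
    exists_contDiff_cutoff_eq_one_nhds hO hK hKO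
  have hχsupp : ∀ v, χ v ≠ 0 → v ∈ O := fun v hv => hχO (subset_tsupport _ hv)
  set a0 : W → (W →L[ℝ] W) := fun v => χ v • A0 v + (1 - χ v) • (1 : W →L[ℝ] W) with ha0_def
  set a : Fin d → W → (W →L[ℝ] W) := fun j v => χ v • A j v + (1 - χ v) • (0 : W →L[ℝ] W)
    with ha_def
  have ha0s : ContDiff ℝ ∞ a0 := contDiff_cutoffComb hO hχ hχO hA0 1
  have has : ∀ j, ContDiff ℝ ∞ (a j) := fun j => contDiff_cutoffComb hO hχ hχO (hA j) 0
  have hone : ∀ w w' : W, ⟪(1 : W →L[ℝ] W) w, w'⟫_ℝ = ⟪w, (1 : W →L[ℝ] W) w'⟫_ℝ := fun w w' => by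
    simp
  have hzero : ∀ w w' : W, ⟪(0 : W →L[ℝ] W) w, w'⟫_ℝ = ⟪w, (0 : W →L[ℝ] W) w'⟫_ℝ := fun w w' => by
    simp
  have ha0sy : ∀ v (w w' : W), ⟪a0 v w, w'⟫_ℝ = ⟪w, a0 v w'⟫_ℝ := fun v w w' =>
    inner_cutoffComb_symm (fun v hv w w' => hsymm0 v (hχsupp v hv) w w') hone v w w'
  have hasy : ∀ j v (w w' : W), ⟪a j v w, w'⟫_ℝ = ⟪w, a j v w'⟫_ℝ := fun j v w w' =>
    inner_cutoffComb_symm (fun v hv w w' => hsymm j v (hχsupp v hv) w w') hzero v w w'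
  obtain ⟨c₀, hc₀, hcoer⟩ := le_inner_cutoffComb_self hχc hχO hχ01 hA0.continuousOn hpos
  obtain ⟨Λ₀, hΛ₀⟩ :=
    exists_forall_norm_iteratedFDeriv_cutoffComb_le hO hχ hχc hχO hA0 (1 : W →L[ℝ] W) 0
  have hnorm : ∀ v, ‖a0 v‖ ≤ Λ₀ := fun v => by
    have h := hΛ₀ v
    rwa [norm_iteratedFDeriv_zero] at h
  -- Step 2: the congruence
  have hpd : ∀ v, IsPosDefSymm (a0 v) := fun v => isPosDefSymm_of_coercive (ha0sy v) hc₀ (hcoer v)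
  set p : W → (W →L[ℝ] W) := fun v => Ring.inverse (posSqrt (a0 v)) with hp_def
  have hps : ContDiff ℝ ∞ p := contDiff_inverse_posSqrt_comp ha0s hpd
  have hQL : IsQLSymmCoeff c₀ Λ₀ a0 a p p :=
    { smooth₀ := ha0s
      smooth := has
      smooth_p := hps
      smooth_q := hps
      symm₀ := ha0sy
      symm := hasy
      pos := hc₀
      coer := hcoer
      norm_le := hnorm
      adj := fun v w w' => inner_inverse_posSqrt_symm (hpd v) w w'
      inv := fun v w => inverse_posSqrt_apply_apply (hpd v) w }
  -- Step 3: the solution of the modified system — Majda's theorem on `𝕋ᵈ` in the `C^∞` class at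
  -- the margin `σ = d + 1` (`d < 2σ`)
  obtain ⟨T, hT, V, hVs, hV0, hVeq⟩ :=
    hQL.exists_smooth_solution_of_wordSup (wordSupEmbedding_fin (σ := d + 1) (by omega)) hU₀
  -- Step 4: localisation in time (tube lemma)
  obtain ⟨δ, hδ, hδO'⟩ := hK.exists_cthickening_subset_open hO' hKO'
  have h0 : (0 : ℝ) ∈ Ioo (-T) T := ⟨by linarith, hT⟩
  have hev := hVs.eventually_norm_sub_lt h0 hδ
  rw [eventually_nhdsWithin_iff, Metric.eventually_nhds_iff] at hev
  obtain ⟨τ, hτ, hball⟩ := hev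
  have hsub : Ioo (-min T τ) (min T τ) ⊆ Ioo (-T) T := fun t ht =>
    ⟨lt_of_le_of_lt (neg_le_neg (min_le_left T τ)) ht.1, lt_of_lt_of_le ht.2 (min_le_left T τ)⟩
  have hin : ∀ t ∈ Ioo (-min T τ) (min T τ), ∀ x, V t x ∈ O' := by
    intro t ht x
    have htT : t ∈ Ioo (-T) T := hsub ht
    have htτ : dist t 0 < τ := by
      rw [Real.dist_eq, sub_zero, abs_lt]
      exact ⟨lt_of_le_of_lt (neg_le_neg (min_le_right T τ)) ht.1,
        lt_of_lt_of_le ht.2 (min_le_right T τ)⟩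
    have h1 : ‖V t x - V 0 x‖ < δ := hball htτ htT x
    refine hδO' (thickening_subset_cthickening δ K ?_)
    rw [mem_thickening_iff]
    refine ⟨U₀ x, hU₀K x, ?_⟩
    rw [dist_eq_norm, ← hV0]
    exact h1
  refine ⟨min T τ, lt_min hT hτ, V, hVs.mono hsub, hV0, fun t ht x => hO'O (hin t ht x),
    fun t ht x => ?_⟩
  have hv1 : χ (V t x) = 1 := hχ1 _ (hin t ht x)
  have e0 : a0 (V t x) = A0 (V t x) := cutoffComb_eq_of_eq_one (1 : W →L[ℝ] W) hv1
  have e : ∀ j, a j (V t x) = A j (V t x) := fun j => cutoffComb_eq_of_eq_one (0 : W →L[ℝ] W) hv1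
  have h := hVeq t (hsub ht) x
  rw [e0] at h
  simp only [e] at h
  exact h

/-- **Forward form on `𝕋ᵈ`, every `d`** of `exists_smooth_solution_of_compact_range_dim`: a jointly
smooth solution on `[0, T) × 𝕋ᵈ` with the one-sided time derivative within `[0, T)`, values in
`𝒪`, and `V(0) = U₀` (the `d = 3` instance is `exists_smooth_solution_of_compact_range_Ico`).
[cite: Majda1984, Ch. 2 §2.1, Thm 2.1; Dafermos2005, Thm 5.1.1; Kato1975, Thm II] -/
theorem exists_smooth_solution_of_compact_range_Ico_dim {d : ℕ} {O : Set W} (hO : IsOpen O)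
    {A0 : W → (W →L[ℝ] W)} {A : Fin d → W → (W →L[ℝ] W)}
    (hA0 : ContDiffOn ℝ ∞ A0 O) (hA : ∀ j, ContDiffOn ℝ ∞ (A j) O)
    (hsymm0 : ∀ v ∈ O, ∀ w w' : W, ⟪A0 v w, w'⟫_ℝ = ⟪w, A0 v w'⟫_ℝ)
    (hpos : ∀ v ∈ O, ∀ w : W, w ≠ 0 → 0 < ⟪A0 v w, w⟫_ℝ)
    (hsymm : ∀ j, ∀ v ∈ O, ∀ w w' : W, ⟪A j v w, w'⟫_ℝ = ⟪w, A j v w'⟫_ℝ)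
    {K : Set W} (hK : IsCompact K) (hKO : K ⊆ O)
    {U₀ : UnitAddTorus (Fin d) → W} (hU₀ : IsSmooth U₀) (hU₀K : ∀ x, U₀ x ∈ K) :
    ∃ T : ℝ, 0 < T ∧ ∃ V : ℝ → UnitAddTorus (Fin d) → W,
      IsSmoothSpaceTimeOn (Ico 0 T) V ∧ V 0 = U₀ ∧ (∀ t ∈ Ico 0 T, ∀ x, V t x ∈ O) ∧
      ∀ t ∈ Ico 0 T, ∀ x,
        A0 (V t x) (timeDerivWithin (Ico 0 T) V t x) +
          ∑ j, A j (V t x) (partialDeriv j (V t) x) = 0 := by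
  obtain ⟨T, hT, V, hVs, hV0, hVO, hVeq⟩ :=
    exists_smooth_solution_of_compact_range_dim hO hA0 hA hsymm0 hpos hsymm hK hKO hU₀ hU₀K
  have hsub : Ico 0 T ⊆ Ioo (-T) T := fun t ht => ⟨by linarith [ht.1], ht.2⟩
  refine ⟨T, hT, V, hVs.mono hsub, hV0, fun t ht x => hVO t (hsub ht) x, fun t ht x => ?_⟩
  have htd : timeDerivWithin (Ico 0 T) V t x = timeDeriv V t x := by
    have h1 := hVs.hasDerivWithinAt_slice (hsub ht) x
    have h2 : HasDerivAt (fun τ => V τ x) (timeDerivWithin (Ioo (-T) T) V t x) t :=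
      h1.hasDerivAt (Ioo_mem_nhds (hsub ht).1 (hsub ht).2)
    unfold timeDerivWithin timeDeriv
    rw [h2.differentiableAt.derivWithin (uniqueDiffOn_Ico 0 T t ht)]
  rw [htd]
  exact hVeq t (hsub ht) x

/-- **The local existence theorem in matrix language on `𝕋ᵈ`, EVERY `d`, general symmetric
positive definite symmetriser** — for every `d` and `N`, every open `𝒪 ⊆ ℝᴺ`, all coefficient
matrices `A⁰, A₁, …, A_d` smooth on `𝒪` with `A⁰` symmetric positive definite and the `Aₖ`
symmetric on `𝒪`, and all smooth data `V₀ : 𝕋ᵈ → ℝᴺ` with values in a compact subset of `𝒪`,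
there are `T > 0` and a jointly smooth `V` on `[0, T) × 𝕋ᵈ` with values in `𝒪`, `V(0) = V₀`,
solving `A⁰(V)∂ₜV + ∑ₖ Aₖ(V)∂ₖV = 0` (one-sided time derivative within `[0, T)`). From
`exists_smooth_solution_of_compact_range_Ico_dim` on `W = ℝᴺ` through `Matrix.toEuclideanCLM`.
This is LITERALLY the named fact `SymmHyperbolicLocalExistenceDim d` (`[X_d]`, Kato 1975 Thm II,
statement file `SymmHyperbolicLocalExistenceDim`) for every `d`; its `d = 3` instance is
`symmHyperbolicLocalExistence_matrix`.
[cite: Majda1984, Ch. 2 §2.1, Thm 2.1; Dafermos2005, Thm 5.1.1; Kato1975, Thm II] -/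
theorem symmHyperbolicLocalExistence_matrix_dim (d N : ℕ) (O : Set (EuclideanSpace ℝ (Fin N)))
    (A₀ : EuclideanSpace ℝ (Fin N) → Matrix (Fin N) (Fin N) ℝ)
    (A : Fin d → EuclideanSpace ℝ (Fin N) → Matrix (Fin N) (Fin N) ℝ) (hO : IsOpen O)
    (hA0 : ∀ i j, ContDiffOn ℝ ∞ (fun v => A₀ v i j) O)
    (hA : ∀ k i j, ContDiffOn ℝ ∞ (fun v => A k v i j) O)
    (hPD : ∀ v ∈ O, (A₀ v).PosDef) (hSy : ∀ k, ∀ v ∈ O, (A k v).IsSymm)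
    (V₀ : UnitAddTorus (Fin d) → EuclideanSpace ℝ (Fin N)) (hV₀ : IsSmooth V₀)
    (hK : ∃ K, IsCompact K ∧ K ⊆ O ∧ ∀ x, V₀ x ∈ K) :
    ∃ T : ℝ, 0 < T ∧ ∃ V : ℝ → UnitAddTorus (Fin d) → EuclideanSpace ℝ (Fin N),
      IsSmoothSpaceTimeOn (Ico 0 T) V ∧ V 0 = V₀ ∧ (∀ t ∈ Ico 0 T, ∀ x, V t x ∈ O) ∧
      ∀ t ∈ Ico 0 T, ∀ x,
        (A₀ (V t x)).mulVec (WithLp.ofLp (timeDerivWithin (Ico 0 T) V t x)) +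
          ∑ k, (A k (V t x)).mulVec (WithLp.ofLp (partialDeriv k (V t) x)) = 0 := by
  obtain ⟨K, hKc, hKO, hV₀K⟩ := hK
  have hT0 : ContDiffOn ℝ ∞ (fun v => Matrix.toEuclideanCLM (n := Fin N) (𝕜 := ℝ) (A₀ v)) O :=
    contDiffOn_toEuclideanCLM hA0
  have hT : ∀ k, ContDiffOn ℝ ∞ (fun v => Matrix.toEuclideanCLM (n := Fin N) (𝕜 := ℝ) (A k v)) O :=
    fun k => contDiffOn_toEuclideanCLM (hA k)
  have hsymm0 : ∀ v ∈ O, ∀ w w' : EuclideanSpace ℝ (Fin N),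
      ⟪Matrix.toEuclideanCLM (n := Fin N) (𝕜 := ℝ) (A₀ v) w, w'⟫_ℝ =
        ⟪w, Matrix.toEuclideanCLM (n := Fin N) (𝕜 := ℝ) (A₀ v) w'⟫_ℝ := fun v hv w w' =>
    inner_toEuclideanCLM_symm (Matrix.isHermitian_iff_isSymm.1 (hPD v hv).isHermitian) w w'
  have hpos : ∀ v ∈ O, ∀ w : EuclideanSpace ℝ (Fin N), w ≠ 0 →
      0 < ⟪Matrix.toEuclideanCLM (n := Fin N) (𝕜 := ℝ) (A₀ v) w, w⟫_ℝ := fun v hv w hw =>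
    inner_toEuclideanCLM_pos (hPD v hv) hw
  have hsymm : ∀ k, ∀ v ∈ O, ∀ w w' : EuclideanSpace ℝ (Fin N),
      ⟪Matrix.toEuclideanCLM (n := Fin N) (𝕜 := ℝ) (A k v) w, w'⟫_ℝ =
        ⟪w, Matrix.toEuclideanCLM (n := Fin N) (𝕜 := ℝ) (A k v) w'⟫_ℝ := fun k v hv w w' =>
    inner_toEuclideanCLM_symm (hSy k v hv) w w'
  obtain ⟨T, hTpos, V, hVs, hV0, hVO, hVeq⟩ :=
    exists_smooth_solution_of_compact_range_Ico_dim hO hT0 hT hsymm0 hpos hsymm hKc hKO hV₀ hV₀K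
  refine ⟨T, hTpos, V, hVs, hV0, hVO, fun t ht x => ?_⟩
  have h := congrArg WithLp.ofLp (hVeq t ht x)
  simpa [WithLp.ofLp_add, WithLp.ofLp_sum, ofLp_toEuclideanCLM] using h

/-! ### On `𝕋³` (the statements of record; `d = 3` instances) -/

/-- **Local classical solutions of quasilinear symmetric hyperbolic systems on `𝕋³`** (Majda
1984, Thm 2.1 with Cor. 1–2 of Thm 2.2; Dafermos 2005, Thm 5.1.1, existence; Kato 1975). Let
`A₀, A₁, A₂, A₃ : W → End(W)` be smooth on an open set `𝒪` of the finite-dimensional real inner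
product space `W`, with `A₀(v)` symmetric positive definite and `Aⱼ(v)` symmetric for `v ∈ 𝒪`,
and let `U₀ : 𝕋³ → W` be smooth with values in a compact `K ⊆ 𝒪`. Then there are `T > 0` and
`V` jointly `C^∞` on `(-T, T) × 𝕋³`, with values in `𝒪`, `V(0) = U₀`, and
`A₀(V)∂ₜV + ∑ⱼ Aⱼ(V)∂ⱼV = 0` on `(-T, T) × 𝕋³`. Proof: cut the coefficients off outside a
neighbourhood `𝒪'` of `K` (`ã₀ = χA₀ + (1 - χ)1`, `ãⱼ = χAⱼ`), take the congruence
`P = Q = (√ã₀)⁻¹`, solve the modified system by `IsQLSymmCoeff.exists_smooth_solution`, and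
shrink `T` so that the solution stays in `𝒪'` (tube lemma), where the modified system is the
original one. [cite: Majda1984, Ch. 2 §2.1, Thm 2.1; Dafermos2005, Thm 5.1.1] -/
theorem exists_smooth_solution_of_compact_range {O : Set W} (hO : IsOpen O)
    {A0 : W → (W →L[ℝ] W)} {A : Fin 3 → W → (W →L[ℝ] W)}
    (hA0 : ContDiffOn ℝ ∞ A0 O) (hA : ∀ j, ContDiffOn ℝ ∞ (A j) O)
    (hsymm0 : ∀ v ∈ O, ∀ w w' : W, ⟪A0 v w, w'⟫_ℝ = ⟪w, A0 v w'⟫_ℝ)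
    (hpos : ∀ v ∈ O, ∀ w : W, w ≠ 0 → 0 < ⟪A0 v w, w⟫_ℝ)
    (hsymm : ∀ j, ∀ v ∈ O, ∀ w w' : W, ⟪A j v w, w'⟫_ℝ = ⟪w, A j v w'⟫_ℝ)
    {K : Set W} (hK : IsCompact K) (hKO : K ⊆ O)
    {U₀ : UnitAddTorus (Fin 3) → W} (hU₀ : IsSmooth U₀) (hU₀K : ∀ x, U₀ x ∈ K) :
    ∃ T : ℝ, 0 < T ∧ ∃ V : ℝ → UnitAddTorus (Fin 3) → W,
      IsSmoothSpaceTimeOn (Ioo (-T) T) V ∧ V 0 = U₀ ∧ (∀ t ∈ Ioo (-T) T, ∀ x, V t x ∈ O) ∧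
      ∀ t ∈ Ioo (-T) T, ∀ x,
        A0 (V t x) (timeDeriv V t x) + ∑ j, A j (V t x) (partialDeriv j (V t) x) = 0 :=
  exists_smooth_solution_of_compact_range_dim hO hA0 hA hsymm0 hpos hsymm hK hKO hU₀ hU₀K

/-- **Forward form** of `exists_smooth_solution_of_compact_range`: a jointly smooth solution on
`[0, T) × 𝕋³` with the one-sided time derivative within `[0, T)` (the convention of the tree's
solution notions), values in `𝒪`, and `V(0) = U₀`.
[cite: Majda1984, Ch. 2 §2.1, Thm 2.1; Dafermos2005, Thm 5.1.1] -/
theorem exists_smooth_solution_of_compact_range_Ico {O : Set W} (hO : IsOpen O)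
    {A0 : W → (W →L[ℝ] W)} {A : Fin 3 → W → (W →L[ℝ] W)}
    (hA0 : ContDiffOn ℝ ∞ A0 O) (hA : ∀ j, ContDiffOn ℝ ∞ (A j) O)
    (hsymm0 : ∀ v ∈ O, ∀ w w' : W, ⟪A0 v w, w'⟫_ℝ = ⟪w, A0 v w'⟫_ℝ)
    (hpos : ∀ v ∈ O, ∀ w : W, w ≠ 0 → 0 < ⟪A0 v w, w⟫_ℝ)
    (hsymm : ∀ j, ∀ v ∈ O, ∀ w w' : W, ⟪A j v w, w'⟫_ℝ = ⟪w, A j v w'⟫_ℝ)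
    {K : Set W} (hK : IsCompact K) (hKO : K ⊆ O)
    {U₀ : UnitAddTorus (Fin 3) → W} (hU₀ : IsSmooth U₀) (hU₀K : ∀ x, U₀ x ∈ K) :
    ∃ T : ℝ, 0 < T ∧ ∃ V : ℝ → UnitAddTorus (Fin 3) → W,
      IsSmoothSpaceTimeOn (Ico 0 T) V ∧ V 0 = U₀ ∧ (∀ t ∈ Ico 0 T, ∀ x, V t x ∈ O) ∧
      ∀ t ∈ Ico 0 T, ∀ x,
        A0 (V t x) (timeDerivWithin (Ico 0 T) V t x) +
          ∑ j, A j (V t x) (partialDeriv j (V t) x) = 0 :=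
  exists_smooth_solution_of_compact_range_Ico_dim hO hA0 hA hsymm0 hpos hsymm hK hKO hU₀ hU₀K

/-- **The local existence theorem in matrix language, general symmetric positive definite
symmetriser** — verbatim the hypothesis `H` of
`Literature.MathematicalPhysics.KineticTheory.hsEuler_localExistence_of_symmHyperbolicLocalExistence`:
for every `N`, every open `𝒪 ⊆ ℝᴺ`, all coefficient matrices `A⁰, A₁, A₂, A₃` smooth on `𝒪`
with `A⁰` symmetric positive definite and the `Aₖ` symmetric on `𝒪`, and all smooth data
`V₀ : 𝕋³ → ℝᴺ` with values in a compact subset of `𝒪`, there are `T > 0` and a jointly smooth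
`V` on `[0, T) × 𝕋³` with values in `𝒪`, `V(0) = V₀`, solving `A⁰(V)∂ₜV + ∑ₖ Aₖ(V)∂ₖV = 0`
(one-sided time derivative within `[0, T)`). From `exists_smooth_solution_of_compact_range_Ico`
on `W = ℝᴺ` through the dictionary `Matrix.toEuclideanCLM`.
[cite: Majda1984, Ch. 2 §2.1, Thm 2.1; Dafermos2005, Thm 5.1.1] -/
theorem symmHyperbolicLocalExistence_matrix (N : ℕ) (O : Set (EuclideanSpace ℝ (Fin N)))
    (A₀ : EuclideanSpace ℝ (Fin N) → Matrix (Fin N) (Fin N) ℝ)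
    (A : Fin 3 → EuclideanSpace ℝ (Fin N) → Matrix (Fin N) (Fin N) ℝ) (hO : IsOpen O)
    (hA0 : ∀ i j, ContDiffOn ℝ ∞ (fun v => A₀ v i j) O)
    (hA : ∀ k i j, ContDiffOn ℝ ∞ (fun v => A k v i j) O)
    (hPD : ∀ v ∈ O, (A₀ v).PosDef) (hSy : ∀ k, ∀ v ∈ O, (A k v).IsSymm)
    (V₀ : UnitAddTorus (Fin 3) → EuclideanSpace ℝ (Fin N)) (hV₀ : IsSmooth V₀)
    (hK : ∃ K, IsCompact K ∧ K ⊆ O ∧ ∀ x, V₀ x ∈ K) :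
    ∃ T : ℝ, 0 < T ∧ ∃ V : ℝ → UnitAddTorus (Fin 3) → EuclideanSpace ℝ (Fin N),
      IsSmoothSpaceTimeOn (Ico 0 T) V ∧ V 0 = V₀ ∧ (∀ t ∈ Ico 0 T, ∀ x, V t x ∈ O) ∧
      ∀ t ∈ Ico 0 T, ∀ x,
        (A₀ (V t x)).mulVec (WithLp.ofLp (timeDerivWithin (Ico 0 T) V t x)) +
          ∑ k, (A k (V t x)).mulVec (WithLp.ofLp (partialDeriv k (V t) x)) = 0 :=
  symmHyperbolicLocalExistence_matrix_dim 3 N O A₀ A hO hA0 hA hPD hSy V₀ hV₀ hK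

end LocalExistence

end Literature.Analysis.PDE

end
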